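/-
Copyright (c) 2026 the pub-hodgecm-mathlib formalisation cell (harness21).  Prover seat hodgecm-mathlib-R90-C10-p03 (g0) (cross-line hand, CHAIR VALVE 13 → S4 dealer
K2E2-plan (g7) deal (f), 2026-09-05T01:47:05Z).  Programme R90-TF, section S4 «Ch. 13.1–2», T-WIF road: the first third of the (B1-Σ) head —
«SING-ε off → COVER-ε + TUBE-EQ partition of the ε-regular set by the stable classes of members → Σ over representatives».  THEOREMS ONLY.
-/
import Summits.HodgeConjecture.HodgeConjecture.Theorems.R90S4EpsTubeEq                  -- ★ p864077 TUBE-EQ `tube_iff_or_disjoint_of_dict` (+ ★ `IsStableTransportDict`, `IsEpsNormPair`, `Gqs`, `GtLoc`)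
import Summits.HodgeConjecture.HodgeConjecture.Theorems.R90S4EpsTubeCover               -- ★ COVER-ε `exists_mem_cartan_isEpsNormPair_of_isEpsRegularAt`
import Summits.HodgeConjecture.HodgeConjecture.Theorems.R90S4EpsOrbitalCanonical         -- ★ `continuous_epsLoc`
import Summits.HodgeConjecture.HodgeConjecture.Theorems.R90S4EpsRegularTransport         -- ★ `isEpsRegularAt_iff_isRegularElt_of_isEpsNormPair`
import Summits.HodgeConjecture.HodgeConjecture.Theorems.F0P3cStCharTSWeylCartanRadial    -- ★ `isClosed_cartan`, `measurableSet_setOf_isRegularElt`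
import Literature.NumberTheory.Automorphic.LocalUnitaryGroupCongrMeasure                -- ★ `locallyCompactSpace_localGL`, `secondCountableTopology_localGL`, `…_cmDatum_local`
import Mathlib.MeasureTheory.Integral.Bochner.Set
import HarnessLib

/-!
# R90-TF · S4 «Ch. 13.1–2», T-WIF road, (B1-Σ) first third — THE ε-REGULAR SET OF `G̃_v` IS PARTITIONED, UP TO A `νGt`-NULL SET, BY FINITELY MANY NORM TUBES,
# ONE PER STABLE CLASS OF MEMBERS OF THE CARTAN SYSTEM, AND INTEGRALS SPLIT ACCORDINGLY (Rogawski 1990, §12.5 p. 186)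

Cell `hodgecm-mathlib`, crux H413 (`stmt-HodgeConjecture-24833`, lane `--supports … --as helper`, count-neutral), route of record `HCCMUnconditional` (no route verbs).
Programme R90-TF, section S4, dealer K2E2-plan (g7) (deal (f) 2026-09-05T01:47:05Z under CHAIR VALVE 13); census of record R90-C131-p03 (g3)
`R90/R90-C131-p03/g3/CENSUS-B1-assembly.md` §3–§4.  THE TUBE over a member `T` of the Cartan system (no `def`; ★ TUBE-EQ's bytes, written inline):
`{δ : G̃_v | ∃ t : ↥T, IsRegularElt (↑t).val ∧ IsEpsNormPair L (splitFormGL L) v δ ↑t}` — «`δ` has a norm among the regular points of `T`».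
* (P1) **`measurableSet_normTube`** — the tube over a Cartan subgroup `T = Z(γ₀)` is Borel.  ROAD (σ-compact image; no injectivity): the tube is the preimage under the
  continuous norm map `N = δ ↦ δ·ε(δ)` (★ `continuous_epsLoc`) of `S_T = {c⁻¹ t c | c ∈ G̃_v, t ∈ T^{reg}}` (`IsEpsNormPair δ t ⟺ IsConj (N δ) t`, `Iff.rfl` + Mathlib `isConj_iff`),
  the continuous image of the locally closed — `T` closed (★ `isClosed_cartan`), regular locus open (★ `isOpen_setOf_isRegularElt_cmDatum_local`, non-split `v`) — hence locally
  compact second countable, hence σ-compact subspace `G̃_v × T^{reg}` of `G̃_v × G_v` (★ `locallyCompactSpace_localGL` ∕ `secondCountableTopology_localGL` ∕ `…_cmDatum_local`);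
  σ-compact sets of the Hausdorff group `G̃_v` are Borel.
* (P2) **`normTube_eq_or_disjoint`** — two members' tubes COINCIDE or are DISJOINT (★ TUBE-EQ `tube_iff_or_disjoint_of_dict`, as sets).
* (P3) **`exists_normTube_representatives`** — a finite set `K ⊆ C` of members with PAIRWISE DISJOINT tubes whose union is EXACTLY the ε-regular set of `G̃_v` (one member per value of
  `k ↦ tube k`, finite choice; `⊆` ★ `isEpsRegularAt_iff_isRegularElt_of_isEpsNormPair`, `⊇` ★ COVER-ε `exists_mem_cartan_isEpsNormPair_of_isEpsRegularAt`).
* (P4) **`integral_eq_sum_integral_normTube`** (Bochner, any complete real normed space `E`), **`setIntegral_eq_sum_setIntegral_normTube`** (on any set `A`) and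
  **`lintegral_eq_sum_lintegral_normTube`** — with SING-ε (`νGt {δ | ¬ IsEpsRegularAt δ} = 0`, p04's binder) the tubes of `K` carry `νGt`, so `∫ f dνGt = Σ_{k ∈ K} ∫_{tube k} f dνGt`
  (Mathlib `Measure.restrict_eq_self_of_ae_mem` + `integral_biUnion_finset` ∕ `lintegral_biUnion_finset`); `K` and its two properties are taken BY VALUE (obtained ONCE from (P3)),
  so every `f`, `A`, `E` uses the SAME representatives.
PINS = the group-theoretic block of ★ p863960 `isStableWeylMeasure_stableCartanMeasure_of_dict` :280 VERBATIM (`(hns) {C} (hZ) (hcov) (hirr) {n} (hdict)`; each head takes the pins it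
uses) + the frame `[MeasurableSpace (GtLoc L v)] [BorelSpace (GtLoc L v)] (νGt : Measure (GtLoc L v))` + SING-ε `(hsing)`.
HONEST LABEL: HC_CM is proved only modulo the 7 printed citations (2 remaining named inputs: hLiu418 = stmt-HodgeConjecture-24832, h413 = stmt-HodgeConjecture-24833) until rung 0
closes.  This is ONE input of the (B1-Σ) T-WIF assembly behind the OPEN (W-NP); set algebra + point-set topology, no analysis; it closes no socket.  REL ≠ ★ ≠ BUILT.
Theorems only; no instance, no notation, no named-fact hypothesis, no `sorry`.

## References
* [Rogawski1990] J. D. Rogawski, *Automorphic Representations of Unitary Groups in Three Variables*, Ann. of Math. Stud. 123 (1990), §12.5 p. 186 («a set of representatives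
  for the ε-conjugacy classes of ε-regular elements»); §3.11 Prop. 3.11.1 pp. 34–35; §3.6 pp. 28–31.
* [Kechris1995] A. S. Kechris, *Classical Descriptive Set Theory*, GTM 156 (1995), §5.B (σ-compact = `K_σ` sets are Borel).
-/

set_option autoImplicit false
set_option linter.dupNamespace false

noncomputable section

open MeasureTheory Measure Set Filter Topology Function NumberField IsDedekindDomain
open Literature.MeasureTheory.Group
open Literature.NumberTheory.Automorphic Literature.NumberTheory.Automorphic.UnitaryGroup Literature.NumberTheory.Rogawski1990
open Literature.NumberTheory.Rogawski1990.Ch4Sec10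
open Summit.HodgeConjecture.HodgeConjecture.Cruxes.H413
open Summit.HodgeConjecture.HodgeConjecture.Cruxes.H413.F0P3cStCharTSWeylCartanRadial
open scoped ENNReal NNReal MatrixGroups Pointwise

namespace Summit.HodgeConjecture.HodgeConjecture.R90.S4

section Partition

variable (L : Type) [Field L] [NumberField L] [IsCMField L] (v : HeightOneSpectrum (𝓞 ↥(maximalRealSubfield L)))

/-! ## (P1) The norm tube over a Cartan subgroup is Borel -/

variable {L v} in
/-- **(P1) THE NORM TUBE OVER A CARTAN SUBGROUP `T = Z(γ₀)` IS BOREL** (`v` non-split).  The tube `{δ | ∃ t ∈ T^{reg}, N δ ∼ t}` is the preimage under the continuous norm map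
`N = δ ↦ δ·ε(δ)` of the set `{c⁻¹ t c}` (`c ∈ G̃_v`, `t ∈ T^{reg}`), a continuous image of the σ-compact space `G̃_v × T^{reg}` (`T` closed, the regular locus open: a locally closed
subspace of a locally compact second countable group), hence σ-compact, hence Borel in the Hausdorff group `G̃_v`. [cite: Rogawski1990, §12.5 p. 186; §3.1 p. 19]
[cite: Kechris1995, §5.B] -/
theorem measurableSet_normTube (hns : ∀ w : PlacesOver L v, IsCMField.complexConj L • w.1 = w.1)
    {T : Subgroup (Gqs L v)} {γ₀ : Gqs L v} (hT : T = Subgroup.centralizer ({γ₀} : Set (Gqs L v)))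
    [MeasurableSpace (GtLoc L v)] [BorelSpace (GtLoc L v)] :
    MeasurableSet {δ : GtLoc L v | ∃ t : ↥T, IsRegularElt (((t : Gqs L v)).val : GL (Fin 3) (LocalRing L v)) ∧ IsEpsNormPair L (R90.S4.splitFormGL L) v δ (t : Gqs L v)} := by
  classical
  obtain ⟨w⟩ := (inferInstance : Nonempty (PlacesOver L v))
  haveI : LocallyCompactSpace (Gqs L v) := locallyCompactSpace_cmDatum_local (L := L) (N := 3) (H := qsForm L) (v := v)
  haveI : SecondCountableTopology (Gqs L v) := secondCountableTopology_cmDatum_local (L := L) (N := 3) (H := qsForm L) (v := v)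
  haveI : T2Space (Gqs L v) := t2Space_cmDatum_local (L := L) (N := 3) (H := qsForm L) (v := v)
  haveI : LocallyCompactSpace (GtLoc L v) := locallyCompactSpace_localGL (E := L) 3 v
  haveI : SecondCountableTopology (GtLoc L v) := secondCountableTopology_localGL (E := L) 3 v
  -- the locally closed domain `G̃_v × T^{reg}` inside `G̃_v × G_v`
  have hDlc : IsLocallyClosed {p : GtLoc L v × Gqs L v | p.2 ∈ T ∧ IsRegularElt ((p.2).val : GL (Fin 3) (LocalRing L v))} := by
    have h1 : IsClosed {p : GtLoc L v × Gqs L v | p.2 ∈ T} := (isClosed_cartan hT).preimage continuous_snd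
    have h2 : IsOpen {p : GtLoc L v × Gqs L v | IsRegularElt ((p.2).val : GL (Fin 3) (LocalRing L v))} :=
      (isOpen_setOf_isRegularElt_cmDatum_local (L := L) (H := qsForm L) (v := v) w (hns w)).preimage continuous_snd
    have h12 : {p : GtLoc L v × Gqs L v | p.2 ∈ T ∧ IsRegularElt ((p.2).val : GL (Fin 3) (LocalRing L v))} =
        {p : GtLoc L v × Gqs L v | p.2 ∈ T} ∩ {p | IsRegularElt ((p.2).val : GL (Fin 3) (LocalRing L v))} := by
      ext p; simp only [Set.mem_setOf_eq, Set.mem_inter_iff]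
    rw [h12]
    exact h1.isLocallyClosed.inter h2.isLocallyClosed
  haveI : LocallyCompactSpace ↥{p : GtLoc L v × Gqs L v | p.2 ∈ T ∧ IsRegularElt ((p.2).val : GL (Fin 3) (LocalRing L v))} := hDlc.locallyCompactSpace
  -- the conjugates of the regular points of `T`: a σ-compact, hence Borel, subset of `G̃_v`
  have hFc : Continuous fun p : ↥{p : GtLoc L v × Gqs L v | p.2 ∈ T ∧ IsRegularElt ((p.2).val : GL (Fin 3) (LocalRing L v))} =>
      (p.1.1)⁻¹ * ((p.1.2 : Gqs L v).val : GtLoc L v) * p.1.1 := by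
    have hc1 : Continuous fun p : ↥{p : GtLoc L v × Gqs L v | p.2 ∈ T ∧ IsRegularElt ((p.2).val : GL (Fin 3) (LocalRing L v))} => p.1.1 :=
      continuous_fst.comp continuous_subtype_val
    have hc2 : Continuous fun p : ↥{p : GtLoc L v × Gqs L v | p.2 ∈ T ∧ IsRegularElt ((p.2).val : GL (Fin 3) (LocalRing L v))} => ((p.1.2 : Gqs L v).val : GtLoc L v) :=
      continuous_subtype_val.comp (continuous_snd.comp continuous_subtype_val)
    exact (hc1.inv.mul hc2).mul hc1
  have hS : MeasurableSet (Set.range fun p : ↥{p : GtLoc L v × Gqs L v | p.2 ∈ T ∧ IsRegularElt ((p.2).val : GL (Fin 3) (LocalRing L v))} =>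
      (p.1.1)⁻¹ * ((p.1.2 : Gqs L v).val : GtLoc L v) * p.1.1) := by
    obtain ⟨K, hKc, hKU⟩ := isSigmaCompact_range hFc
    rw [← hKU]
    exact MeasurableSet.iUnion fun i => (hKc i).measurableSet
  -- the norm map is continuous
  have hN : Measurable fun δ : GtLoc L v => epsNorm (epsLoc L (R90.S4.splitFormGL L) v) δ := by
    refine Continuous.measurable ?_
    change Continuous fun δ : GtLoc L v => δ * epsLoc L (R90.S4.splitFormGL L) v δ
    exact continuous_id.mul (continuous_epsLoc L (R90.S4.splitFormGL L) v)
  -- the tube is the preimage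
  have hEq : {δ : GtLoc L v | ∃ t : ↥T, IsRegularElt (((t : Gqs L v)).val : GL (Fin 3) (LocalRing L v)) ∧ IsEpsNormPair L (R90.S4.splitFormGL L) v δ (t : Gqs L v)} =
      (fun δ : GtLoc L v => epsNorm (epsLoc L (R90.S4.splitFormGL L) v) δ) ⁻¹' (Set.range fun p : ↥{p : GtLoc L v × Gqs L v | p.2 ∈ T ∧ IsRegularElt ((p.2).val : GL (Fin 3) (LocalRing L v))} =>
        (p.1.1)⁻¹ * ((p.1.2 : Gqs L v).val : GtLoc L v) * p.1.1) := by
    ext δ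
    simp only [Set.mem_setOf_eq, Set.mem_preimage, Set.mem_range]
    constructor
    · rintro ⟨t, ht, hδt⟩
      have hδt' : IsConj (epsNorm (epsLoc L (R90.S4.splitFormGL L) v) δ) (((t : Gqs L v)).val : GtLoc L v) := hδt
      obtain ⟨c, hc⟩ := isConj_iff.1 hδt'
      refine ⟨⟨((c, (t : Gqs L v)) : GtLoc L v × Gqs L v), t.2, ht⟩, ?_⟩
      show c⁻¹ * (((t : Gqs L v)).val : GtLoc L v) * c = epsNorm (epsLoc L (R90.S4.splitFormGL L) v) δ
      rw [← hc]
      simp only [← mul_assoc, inv_mul_cancel, one_mul, inv_mul_cancel_right]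
    · rintro ⟨⟨⟨c, t⟩, htT, ht⟩, hp⟩
      refine ⟨⟨t, htT⟩, ht, ?_⟩
      show IsConj (epsNorm (epsLoc L (R90.S4.splitFormGL L) v) δ) (t.val : GtLoc L v)
      refine isConj_iff.2 ⟨c, ?_⟩
      have hp' : c⁻¹ * (t.val : GtLoc L v) * c = epsNorm (epsLoc L (R90.S4.splitFormGL L) v) δ := hp
      rw [← hp']
      simp only [← mul_assoc, mul_inv_cancel, one_mul, mul_inv_cancel_right]
  rw [hEq]
  exact hS.preimage hN

/-! ## (P2) Two members' tubes coincide or are disjoint (★ TUBE-EQ) -/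

variable {L v} in
/-- **(P2) TUBE-EQ AS SETS**: under the stable-transport dictionary (with the `hZ`, `hirr` letters of the Cartan system), the tubes over two members are EQUAL or DISJOINT
(★ `tube_iff_or_disjoint_of_dict`). [cite: Rogawski1990, §12.5 p. 186; §3.11 Prop. 3.11.1 pp. 34–35] -/
theorem normTube_eq_or_disjoint {C : Finset (Subgroup (Gqs L v))} {n : Gqs L v → ℕ} (hdict : IsStableTransportDict L v C n)
    (hZ : ∀ T ∈ C, ∃ γ₀ : Gqs L v, IsRegularElt (γ₀.val : GL (Fin 3) (LocalRing L v)) ∧ T = Subgroup.centralizer ({γ₀} : Set (Gqs L v)))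
    (hirr : ∀ T ∈ C, ∀ T' ∈ C, T ≠ T' → ∀ y : Gqs L v, ¬ ∀ h : Gqs L v, h ∈ T' ↔ y⁻¹ * h * y ∈ T) (i j : ↥C) :
    {δ : GtLoc L v | ∃ t : ↥(i : Subgroup (Gqs L v)), IsRegularElt (((t : Gqs L v)).val : GL (Fin 3) (LocalRing L v)) ∧ IsEpsNormPair L (R90.S4.splitFormGL L) v δ (t : Gqs L v)} =
        {δ : GtLoc L v | ∃ t : ↥(j : Subgroup (Gqs L v)), IsRegularElt (((t : Gqs L v)).val : GL (Fin 3) (LocalRing L v)) ∧ IsEpsNormPair L (R90.S4.splitFormGL L) v δ (t : Gqs L v)} ∨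
      Disjoint
        {δ : GtLoc L v | ∃ t : ↥(i : Subgroup (Gqs L v)), IsRegularElt (((t : Gqs L v)).val : GL (Fin 3) (LocalRing L v)) ∧ IsEpsNormPair L (R90.S4.splitFormGL L) v δ (t : Gqs L v)}
        {δ : GtLoc L v | ∃ t : ↥(j : Subgroup (Gqs L v)), IsRegularElt (((t : Gqs L v)).val : GL (Fin 3) (LocalRing L v)) ∧ IsEpsNormPair L (R90.S4.splitFormGL L) v δ (t : Gqs L v)} := by
  rcases tube_iff_or_disjoint_of_dict L v hdict hZ hirr i j with h | h
  · exact Or.inl (Set.ext fun δ => h δ)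
  · exact Or.inr (Set.disjoint_left.2 fun δ hi hj => h δ ⟨hi, hj⟩)

/-! ## (P3) Representatives: finitely many members with pairwise disjoint tubes covering the ε-regular set -/

variable {L v} in
/-- **(P3) REPRESENTATIVES OF THE STABLE CLASSES OF MEMBERS** (`v` non-split): there is a finite set `K ⊆ C` of members whose tubes are PAIRWISE DISJOINT and whose union is
EXACTLY the ε-regular set of `G̃_v` — one member per value of `k ↦ tube k` (finite choice); disjointness by (P2); `⊆`: a norm among regular points makes `δ` ε-regular
(★ `isEpsRegularAt_iff_isRegularElt_of_isEpsNormPair`); `⊇`: ★ COVER-ε `exists_mem_cartan_isEpsNormPair_of_isEpsRegularAt`.  Print: «a set of representatives for the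
ε-conjugacy classes of ε-regular elements». [cite: Rogawski1990, §12.5 p. 186; §3.11 Prop. 3.11.1 pp. 34–35] -/
theorem exists_normTube_representatives (hns : ∀ w : PlacesOver L v, IsCMField.complexConj L • w.1 = w.1)
    {C : Finset (Subgroup (Gqs L v))}
    (hZ : ∀ T ∈ C, ∃ γ₀ : Gqs L v, IsRegularElt (γ₀.val : GL (Fin 3) (LocalRing L v)) ∧ T = Subgroup.centralizer ({γ₀} : Set (Gqs L v)))
    (hcov : ∀ γ : Gqs L v, IsRegularElt (γ.val : GL (Fin 3) (LocalRing L v)) →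
      ∃ T ∈ C, ∃ x : Gqs L v, ∀ g : Gqs L v, g ∈ Subgroup.centralizer ({γ} : Set (Gqs L v)) ↔ x⁻¹ * g * x ∈ T)
    (hirr : ∀ T ∈ C, ∀ T' ∈ C, T ≠ T' → ∀ y : Gqs L v, ¬ ∀ h : Gqs L v, h ∈ T' ↔ y⁻¹ * h * y ∈ T)
    {n : Gqs L v → ℕ} (hdict : IsStableTransportDict L v C n) :
    ∃ K : Finset ↥C,
      (∀ k ∈ K, ∀ k' ∈ K, k ≠ k' →
        Disjoint
          {δ : GtLoc L v | ∃ t : ↥((k : ↥C) : Subgroup (Gqs L v)), IsRegularElt (((t : Gqs L v)).val : GL (Fin 3) (LocalRing L v)) ∧ IsEpsNormPair L (R90.S4.splitFormGL L) v δ (t : Gqs L v)}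
          {δ : GtLoc L v | ∃ t : ↥((k' : ↥C) : Subgroup (Gqs L v)), IsRegularElt (((t : Gqs L v)).val : GL (Fin 3) (LocalRing L v)) ∧ IsEpsNormPair L (R90.S4.splitFormGL L) v δ (t : Gqs L v)}) ∧
      (⋃ k ∈ K, {δ : GtLoc L v | ∃ t : ↥((k : ↥C) : Subgroup (Gqs L v)), IsRegularElt (((t : Gqs L v)).val : GL (Fin 3) (LocalRing L v)) ∧ IsEpsNormPair L (R90.S4.splitFormGL L) v δ (t : Gqs L v)}) =
        {δ : GtLoc L v | IsEpsRegularAt L (R90.S4.splitFormGL L) v δ} := by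
  classical
  -- the tube map (a local abbreviation inside this proof only)
  set τ : ↥C → Set (GtLoc L v) := fun k =>
    {δ : GtLoc L v | ∃ t : ↥((k : ↥C) : Subgroup (Gqs L v)), IsRegularElt (((t : Gqs L v)).val : GL (Fin 3) (LocalRing L v)) ∧ IsEpsNormPair L (R90.S4.splitFormGL L) v δ (t : Gqs L v)}
    with hτ
  -- one member per value of `τ`
  have hsec : ∀ S ∈ (Finset.univ : Finset ↥C).image τ, ∃ k : ↥C, τ k = S := fun S hS => by
    obtain ⟨k, -, hk⟩ := Finset.mem_image.1 hS
    exact ⟨k, hk⟩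
  refine ⟨((Finset.univ : Finset ↥C).image τ).attach.image fun S => (hsec S.1 S.2).choose, ?_, ?_⟩
  · intro k hk k' hk' hne
    obtain ⟨S, -, rfl⟩ := Finset.mem_image.1 hk
    obtain ⟨S', -, rfl⟩ := Finset.mem_image.1 hk'
    rcases normTube_eq_or_disjoint hdict hZ hirr (hsec S.1 S.2).choose (hsec S'.1 S'.2).choose with h | h
    · exfalso
      apply hne
      have hSS' : (S : Set (GtLoc L v)) = S' := by
        rw [← (hsec S.1 S.2).choose_spec, ← (hsec S'.1 S'.2).choose_spec]
        exact h
      have hSS'' : S = S' := Subtype.ext hSS'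
      subst hSS''
      rfl
    · exact h
  · ext δ
    simp only [Set.mem_iUnion, Set.mem_setOf_eq]
    constructor
    · rintro ⟨k, -, t, ht, hδt⟩
      exact (isEpsRegularAt_iff_isRegularElt_of_isEpsNormPair hδt).2 ht
    · intro hδ
      obtain ⟨T, hTC, γ', hγ'T, hγ'reg, hN⟩ := exists_mem_cartan_isEpsNormPair_of_isEpsRegularAt L v hns C hcov δ hδ
      have hmem : τ ⟨T, hTC⟩ ∈ (Finset.univ : Finset ↥C).image τ := Finset.mem_image_of_mem τ (Finset.mem_univ _)
      refine ⟨(hsec _ hmem).choose, Finset.mem_image.2 ⟨⟨τ ⟨T, hTC⟩, hmem⟩, Finset.mem_attach _ _, rfl⟩, ?_⟩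
      have hδT : δ ∈ τ ⟨T, hTC⟩ := ⟨⟨γ', hγ'T⟩, hγ'reg, hN⟩
      have hk : τ (hsec _ hmem).choose = τ ⟨T, hTC⟩ := (hsec _ hmem).choose_spec
      have hδk : δ ∈ τ (hsec _ hmem).choose := by rw [hk]; exact hδT
      exact hδk

/-! ## (P4) Integrals split along the representatives' tubes (SING-ε) -/

variable {L v} in
/-- **(P4) `∫ f dνGt = Σ_{k ∈ K} ∫_{tube k} f dνGt`** for every integrable `f`, once SING-ε holds (`νGt {δ | ¬ IsEpsRegularAt δ} = 0`) and `K ⊆ C` has pairwise disjoint tubes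
covering the ε-regular set ((P3), taken BY VALUE so that every `f` uses the same representatives): the union of the tubes carries `νGt` (Mathlib `Measure.restrict_eq_self_of_ae_mem`)
and the tubes are Borel ((P1), via `hZ`) and disjoint (Mathlib `integral_biUnion_finset`). [cite: Rogawski1990, §12.5 p. 186] -/
theorem integral_eq_sum_integral_normTube (hns : ∀ w : PlacesOver L v, IsCMField.complexConj L • w.1 = w.1)
    {C : Finset (Subgroup (Gqs L v))}
    (hZ : ∀ T ∈ C, ∃ γ₀ : Gqs L v, IsRegularElt (γ₀.val : GL (Fin 3) (LocalRing L v)) ∧ T = Subgroup.centralizer ({γ₀} : Set (Gqs L v)))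
    [MeasurableSpace (GtLoc L v)] [BorelSpace (GtLoc L v)] (νGt : Measure (GtLoc L v))
    (hsing : νGt {δ : GtLoc L v | ¬ IsEpsRegularAt L (R90.S4.splitFormGL L) v δ} = 0)
    (K : Finset ↥C)
    (hKdisj : ∀ k ∈ K, ∀ k' ∈ K, k ≠ k' →
      Disjoint
        {δ : GtLoc L v | ∃ t : ↥((k : ↥C) : Subgroup (Gqs L v)), IsRegularElt (((t : Gqs L v)).val : GL (Fin 3) (LocalRing L v)) ∧ IsEpsNormPair L (R90.S4.splitFormGL L) v δ (t : Gqs L v)}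
        {δ : GtLoc L v | ∃ t : ↥((k' : ↥C) : Subgroup (Gqs L v)), IsRegularElt (((t : Gqs L v)).val : GL (Fin 3) (LocalRing L v)) ∧ IsEpsNormPair L (R90.S4.splitFormGL L) v δ (t : Gqs L v)})
    (hKcov : (⋃ k ∈ K, {δ : GtLoc L v | ∃ t : ↥((k : ↥C) : Subgroup (Gqs L v)), IsRegularElt (((t : Gqs L v)).val : GL (Fin 3) (LocalRing L v)) ∧ IsEpsNormPair L (R90.S4.splitFormGL L) v δ (t : Gqs L v)}) =
      {δ : GtLoc L v | IsEpsRegularAt L (R90.S4.splitFormGL L) v δ})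
    {E : Type*} [NormedAddCommGroup E] [NormedSpace ℝ E] [CompleteSpace E] (f : GtLoc L v → E) (hf : Integrable f νGt) :
    ∫ δ, f δ ∂νGt = ∑ k ∈ K, ∫ δ in {δ : GtLoc L v | ∃ t : ↥((k : ↥C) : Subgroup (Gqs L v)), IsRegularElt (((t : Gqs L v)).val : GL (Fin 3) (LocalRing L v)) ∧
        IsEpsNormPair L (R90.S4.splitFormGL L) v δ (t : Gqs L v)}, f δ ∂νGt := by
  have hmeas : ∀ k : ↥C, MeasurableSet {δ : GtLoc L v | ∃ t : ↥((k : ↥C) : Subgroup (Gqs L v)), IsRegularElt (((t : Gqs L v)).val : GL (Fin 3) (LocalRing L v)) ∧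
      IsEpsNormPair L (R90.S4.splitFormGL L) v δ (t : Gqs L v)} := fun k => by
    obtain ⟨γ₀, -, hT⟩ := hZ k k.2
    exact measurableSet_normTube hns hT
  have hae : ∀ᵐ δ ∂νGt, δ ∈ ⋃ k ∈ K, {δ : GtLoc L v | ∃ t : ↥((k : ↥C) : Subgroup (Gqs L v)), IsRegularElt (((t : Gqs L v)).val : GL (Fin 3) (LocalRing L v)) ∧
      IsEpsNormPair L (R90.S4.splitFormGL L) v δ (t : Gqs L v)} := by
    rw [hKcov, ae_iff]
    simpa only [Set.mem_setOf_eq] using hsing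
  calc ∫ δ, f δ ∂νGt
      = ∫ δ in ⋃ k ∈ K, {δ : GtLoc L v | ∃ t : ↥((k : ↥C) : Subgroup (Gqs L v)), IsRegularElt (((t : Gqs L v)).val : GL (Fin 3) (LocalRing L v)) ∧
          IsEpsNormPair L (R90.S4.splitFormGL L) v δ (t : Gqs L v)}, f δ ∂νGt := by rw [Measure.restrict_eq_self_of_ae_mem hae]
    _ = _ := integral_biUnion_finset K (fun k _ => hmeas k) (fun k hk k' hk' hne => hKdisj k hk k' hk' hne) (fun k _ => hf.integrableOn)

variable {L v} in
/-- **(P4′) the same on ANY set `A`** (no measurability of `A` needed): `∫_A f dνGt = Σ_{k ∈ K} ∫_{A ∩ tube k} f dνGt` ((P4) for the measure `νGt|_A`, which still kills the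
ε-singular set; the tubes are Borel).
[cite: Rogawski1990, §12.5 p. 186] -/
theorem setIntegral_eq_sum_setIntegral_normTube (hns : ∀ w : PlacesOver L v, IsCMField.complexConj L • w.1 = w.1)
    {C : Finset (Subgroup (Gqs L v))}
    (hZ : ∀ T ∈ C, ∃ γ₀ : Gqs L v, IsRegularElt (γ₀.val : GL (Fin 3) (LocalRing L v)) ∧ T = Subgroup.centralizer ({γ₀} : Set (Gqs L v)))
    [MeasurableSpace (GtLoc L v)] [BorelSpace (GtLoc L v)] (νGt : Measure (GtLoc L v))
    (hsing : νGt {δ : GtLoc L v | ¬ IsEpsRegularAt L (R90.S4.splitFormGL L) v δ} = 0)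
    (K : Finset ↥C)
    (hKdisj : ∀ k ∈ K, ∀ k' ∈ K, k ≠ k' →
      Disjoint
        {δ : GtLoc L v | ∃ t : ↥((k : ↥C) : Subgroup (Gqs L v)), IsRegularElt (((t : Gqs L v)).val : GL (Fin 3) (LocalRing L v)) ∧ IsEpsNormPair L (R90.S4.splitFormGL L) v δ (t : Gqs L v)}
        {δ : GtLoc L v | ∃ t : ↥((k' : ↥C) : Subgroup (Gqs L v)), IsRegularElt (((t : Gqs L v)).val : GL (Fin 3) (LocalRing L v)) ∧ IsEpsNormPair L (R90.S4.splitFormGL L) v δ (t : Gqs L v)})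
    (hKcov : (⋃ k ∈ K, {δ : GtLoc L v | ∃ t : ↥((k : ↥C) : Subgroup (Gqs L v)), IsRegularElt (((t : Gqs L v)).val : GL (Fin 3) (LocalRing L v)) ∧ IsEpsNormPair L (R90.S4.splitFormGL L) v δ (t : Gqs L v)}) =
      {δ : GtLoc L v | IsEpsRegularAt L (R90.S4.splitFormGL L) v δ})
    {E : Type*} [NormedAddCommGroup E] [NormedSpace ℝ E] [CompleteSpace E]
    (A : Set (GtLoc L v)) (f : GtLoc L v → E) (hf : IntegrableOn f A νGt) :
    ∫ δ in A, f δ ∂νGt = ∑ k ∈ K, ∫ δ in A ∩ {δ : GtLoc L v | ∃ t : ↥((k : ↥C) : Subgroup (Gqs L v)), IsRegularElt (((t : Gqs L v)).val : GL (Fin 3) (LocalRing L v)) ∧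
        IsEpsNormPair L (R90.S4.splitFormGL L) v δ (t : Gqs L v)}, f δ ∂νGt := by
  have hmeas : ∀ k : ↥C, MeasurableSet {δ : GtLoc L v | ∃ t : ↥((k : ↥C) : Subgroup (Gqs L v)), IsRegularElt (((t : Gqs L v)).val : GL (Fin 3) (LocalRing L v)) ∧
      IsEpsNormPair L (R90.S4.splitFormGL L) v δ (t : Gqs L v)} := fun k => by
    obtain ⟨γ₀, -, hT⟩ := hZ k k.2
    exact measurableSet_normTube hns hT
  have hsingA : (νGt.restrict A) {δ : GtLoc L v | ¬ IsEpsRegularAt L (R90.S4.splitFormGL L) v δ} = 0 :=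
    le_antisymm ((Measure.restrict_le_self _).trans_eq hsing) bot_le
  have h := integral_eq_sum_integral_normTube hns hZ (νGt.restrict A) hsingA K hKdisj hKcov f hf
  simp only [Measure.restrict_restrict (hmeas _)] at h
  calc ∫ δ in A, f δ ∂νGt = _ := h
    _ = _ := Finset.sum_congr rfl fun k _ => by rw [Set.inter_comm]

variable {L v} in
/-- **(P4″) the `lintegral` twin** (no integrability): `∫⁻ f dνGt = Σ_{k ∈ K} ∫⁻_{tube k} f dνGt` (Mathlib `lintegral_biUnion_finset`). [cite: Rogawski1990, §12.5 p. 186] -/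
theorem lintegral_eq_sum_lintegral_normTube (hns : ∀ w : PlacesOver L v, IsCMField.complexConj L • w.1 = w.1)
    {C : Finset (Subgroup (Gqs L v))}
    (hZ : ∀ T ∈ C, ∃ γ₀ : Gqs L v, IsRegularElt (γ₀.val : GL (Fin 3) (LocalRing L v)) ∧ T = Subgroup.centralizer ({γ₀} : Set (Gqs L v)))
    [MeasurableSpace (GtLoc L v)] [BorelSpace (GtLoc L v)] (νGt : Measure (GtLoc L v))
    (hsing : νGt {δ : GtLoc L v | ¬ IsEpsRegularAt L (R90.S4.splitFormGL L) v δ} = 0)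
    (K : Finset ↥C)
    (hKdisj : ∀ k ∈ K, ∀ k' ∈ K, k ≠ k' →
      Disjoint
        {δ : GtLoc L v | ∃ t : ↥((k : ↥C) : Subgroup (Gqs L v)), IsRegularElt (((t : Gqs L v)).val : GL (Fin 3) (LocalRing L v)) ∧ IsEpsNormPair L (R90.S4.splitFormGL L) v δ (t : Gqs L v)}
        {δ : GtLoc L v | ∃ t : ↥((k' : ↥C) : Subgroup (Gqs L v)), IsRegularElt (((t : Gqs L v)).val : GL (Fin 3) (LocalRing L v)) ∧ IsEpsNormPair L (R90.S4.splitFormGL L) v δ (t : Gqs L v)})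
    (hKcov : (⋃ k ∈ K, {δ : GtLoc L v | ∃ t : ↥((k : ↥C) : Subgroup (Gqs L v)), IsRegularElt (((t : Gqs L v)).val : GL (Fin 3) (LocalRing L v)) ∧ IsEpsNormPair L (R90.S4.splitFormGL L) v δ (t : Gqs L v)}) =
      {δ : GtLoc L v | IsEpsRegularAt L (R90.S4.splitFormGL L) v δ})
    (f : GtLoc L v → ℝ≥0∞) :
    ∫⁻ δ, f δ ∂νGt = ∑ k ∈ K, ∫⁻ δ in {δ : GtLoc L v | ∃ t : ↥((k : ↥C) : Subgroup (Gqs L v)), IsRegularElt (((t : Gqs L v)).val : GL (Fin 3) (LocalRing L v)) ∧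
        IsEpsNormPair L (R90.S4.splitFormGL L) v δ (t : Gqs L v)}, f δ ∂νGt := by
  have hmeas : ∀ k : ↥C, MeasurableSet {δ : GtLoc L v | ∃ t : ↥((k : ↥C) : Subgroup (Gqs L v)), IsRegularElt (((t : Gqs L v)).val : GL (Fin 3) (LocalRing L v)) ∧
      IsEpsNormPair L (R90.S4.splitFormGL L) v δ (t : Gqs L v)} := fun k => by
    obtain ⟨γ₀, -, hT⟩ := hZ k k.2
    exact measurableSet_normTube hns hT
  have hae : ∀ᵐ δ ∂νGt, δ ∈ ⋃ k ∈ K, {δ : GtLoc L v | ∃ t : ↥((k : ↥C) : Subgroup (Gqs L v)), IsRegularElt (((t : Gqs L v)).val : GL (Fin 3) (LocalRing L v)) ∧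
      IsEpsNormPair L (R90.S4.splitFormGL L) v δ (t : Gqs L v)} := by
    rw [hKcov, ae_iff]
    simpa only [Set.mem_setOf_eq] using hsing
  calc ∫⁻ δ, f δ ∂νGt
      = ∫⁻ δ in ⋃ k ∈ K, {δ : GtLoc L v | ∃ t : ↥((k : ↥C) : Subgroup (Gqs L v)), IsRegularElt (((t : Gqs L v)).val : GL (Fin 3) (LocalRing L v)) ∧
          IsEpsNormPair L (R90.S4.splitFormGL L) v δ (t : Gqs L v)}, f δ ∂νGt := by rw [Measure.restrict_eq_self_of_ae_mem hae]
    _ = _ := lintegral_biUnion_finset (fun k hk k' hk' hne => hKdisj k hk k' hk' hne) (fun k _ => hmeas k) f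

end Partition

end Summit.HodgeConjecture.HodgeConjecture.R90.S4

end
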